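import Summits.ResolutionOfSingularities.ResolutionOfSingularities.Theorems.FrobeniusLadderFRationalResolutionEtaleChartExtraction
import HarnessLib

/-!
# Crux `FrobeniusLadder.FRationalResolution` (stmt-ResolutionOfSingularities-15317), line `redirect`,
# stub `stub_diagonalizableQuotientResolution` — brick E with ONE affine neighbourhood of the chart point

`…EtaleChartExtraction.hloc_of_etale_chart_pointBlowup` asks for a regular point blow-up on EVERY affine open
neighbourhood of the chart point `y`; here the hypothesis is reduced to ONE affine open `V₀ ∋ y` (the natural datum:
"`Y` blown up at `y` is regular over `V₀`"), by choosing the auxiliary affine open as a BASIC OPEN of `V₀`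
(`IsAffineOpen.exists_basicOpen_le`) and restricting the regular blow-up to it (`IsAffineOpen.isLocalization_basicOpen`,
`IsAffineOpen.comap_primeIdealOf_appLE` for `𝟙 Y`, `IsLocalization.map_comap`,
`…BlowupFlatCriteria.isRegular_affineBlowup_map_of_isOpenImmersion`).

* `isRegular_affineBlowup_primeIdealOf_basicOpen` — regular point blow-up on `V₀` ⇒ on every basic open `D(s) ∋ y`;
* `hloc_of_etale_chart_pointBlowup_of_affineOpen`, **`hasResolution_of_isolated_etale_pointBlowup_of_affineOpen`**.

Honest label: plumbing + assembly (no stub closed by name). No definitions, no named facts, no sorry.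
[folklore; cite: Kollar2007, §2.2]
-/

noncomputable section

-- single-problem summit: the doubled namespace component is forced
set_option linter.dupNamespace false

open CategoryTheory AlgebraicGeometry TopologicalSpace
open Literature.AlgebraicGeometry.Resolution

namespace Summit.ResolutionOfSingularities.ResolutionOfSingularities.Theorems.FRationalResolution.EtaleChartAffineOpen

/-- **A regular point blow-up on an affine open restricts to its basic opens**: if `Bl_y(Spec Γ(Y, V₀))` is regular
then so is `Bl_y(Spec Γ(Y, D(s)))` for every basic open `D(s) ∋ y` of `V₀` (`Γ(Y, D(s)) = Γ(Y, V₀)_s` and the prime of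
`y` extends). [folklore] -/
theorem isRegular_affineBlowup_primeIdealOf_basicOpen {Y : Scheme.{0}} {V₀ : Y.Opens} (hV₀ : IsAffineOpen V₀)
    (y : Y) (hy₀ : y ∈ V₀) (s : Γ(Y, V₀)) (hys : y ∈ Y.basicOpen s)
    (hreg : Scheme.IsRegular (affineBlowup (hV₀.primeIdealOf ⟨y, hy₀⟩).asIdeal)) :
    Scheme.IsRegular (affineBlowup ((hV₀.basicOpen s).primeIdealOf ⟨y, hys⟩).asIdeal) := by
  haveI : IsLocalization.Away s Γ(Y, Y.basicOpen s) := hV₀.isLocalization_basicOpen s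
  haveI : IsOpenImmersion (Spec.map (CommRingCat.ofHom (algebraMap Γ(Y, V₀) Γ(Y, Y.basicOpen s)))) :=
    IsOpenImmersion.of_isLocalization s
  have e : Y.basicOpen s ≤ (𝟙 Y) ⁻¹ᵁ V₀ := Y.basicOpen_le s
  -- the prime of `y` in `Γ(Y, D(s))` contracts to the prime of `y` in `Γ(Y, V₀)`
  have hcomap : ((hV₀.basicOpen s).primeIdealOf ⟨y, hys⟩).asIdeal.comap
      (algebraMap Γ(Y, V₀) Γ(Y, Y.basicOpen s)) = (hV₀.primeIdealOf ⟨y, hy₀⟩).asIdeal := by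
    have h := hV₀.comap_primeIdealOf_appLE (f := 𝟙 Y) V₀ (Y.basicOpen s) (hV₀.basicOpen s) e hys
    have hρ : ((𝟙 Y :).appLE V₀ (Y.basicOpen s) e).hom = algebraMap Γ(Y, V₀) Γ(Y, Y.basicOpen s) := by
      simp only [Scheme.Hom.appLE, Scheme.Hom.id_app]
      rfl
    rw [hρ] at h
    exact congrArg PrimeSpectrum.asIdeal h
  -- hence it is the extension of that prime
  have hmap : ((hV₀.basicOpen s).primeIdealOf ⟨y, hys⟩).asIdeal =
      (hV₀.primeIdealOf ⟨y, hy₀⟩).asIdeal.map (algebraMap Γ(Y, V₀) Γ(Y, Y.basicOpen s)) := by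
    rw [← hcomap]
    exact (IsLocalization.map_under (Submonoid.powers s) Γ(Y, Y.basicOpen s) _).symm
  rw [hmap]
  exact BlowupFlatCriteria.isRegular_affineBlowup_map_of_isOpenImmersion _ _ hreg

/-- **`hloc` at an isolated singular point from an étale chart and ONE affine open `V₀ ∋ y` of the chart with regular
point blow-up.** [cite: Kollar2007, §2.2] -/
theorem hloc_of_etale_chart_pointBlowup_of_affineOpen (k : Type) [Field k] (X : Scheme.{0}) [IsIntegral X]
    (f : X ⟶ Spec (.of k)) [LocallyOfFiniteType f] (hfin : (Scheme.regularLocus X)ᶜ.Finite)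
    {Y : Scheme.{0}} (φ : Y ⟶ X) [Etale φ] (y : Y) (hx : φ y ∉ Scheme.regularLocus X)
    (V₀ : Y.Opens) (hV₀ : IsAffineOpen V₀) (hy₀ : y ∈ V₀)
    (hreg₀ : Scheme.IsRegular (affineBlowup (hV₀.primeIdealOf ⟨y, hy₀⟩).asIdeal)) :
    ∃ (W : X.Opens), φ y ∈ W ∧ (∀ t : X, t ∉ Scheme.regularLocus X → t ∈ W → t = φ y) ∧
      ∃ (Z : Scheme.{0}) (ρ : Z ⟶ W), IsProper ρ ∧ Scheme.IsRegular Z ∧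
        IsIso (ρ ∣_ (W.ι ⁻¹ᵁ ⟨Scheme.regularLocus X, isOpen_regularLocus_of_locallyOfFiniteType_field f⟩)) ∧
        Dense ((ρ ⁻¹ᵁ (W.ι ⁻¹ᵁ ⟨Scheme.regularLocus X,
          isOpen_regularLocus_of_locallyOfFiniteType_field f⟩) : Z.Opens) : Set Z) := by
  -- restrict the chart to `V₀`: an étale `V₀ → X`, all of whose affine opens containing `y` that we shall meet are
  -- basic opens of `V₀`; we re-run the extraction with a basic open
  classical
  set x := φ y with hxdef
  set T : Set X := (Scheme.regularLocus X)ᶜ \ {x} with hT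
  have hTfin : T.Finite := hfin.subset Set.sdiff_subset
  have hTclosed : IsClosed T := by
    have : T = ⋃ z ∈ T, {z} := (Set.biUnion_of_singleton T).symm
    rw [this]
    exact hTfin.isClosed_biUnion fun z hz =>
      IsolatedClosed.isClosed_singleton_of_finite_singularLocus k X f hfin hz.1
  let W₀ : X.Opens := ⟨Tᶜ, hTclosed.isOpen_compl⟩
  have hxW₀ : x ∈ W₀ := fun h => h.2 rfl
  obtain ⟨U, hU, hxU, hUW⟩ := exists_isAffineOpen_mem_and_subset (U := W₀) hxW₀
  haveI : Nonempty U := ⟨⟨x, hxU⟩⟩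
  set ι := hU.fromSpec with hιdef
  set 𝔭 := hU.primeIdealOf ⟨x, hxU⟩ with h𝔭def
  have hι𝔭 : ι 𝔭 = x := hU.fromSpec_primeIdealOf ⟨x, hxU⟩
  have hxcl : IsClosed ({x} : Set X) := IsolatedClosed.isClosed_singleton_of_finite_singularLocus k X f hfin hx
  haveI h𝔭max : 𝔭.asIdeal.IsMaximal := hU.primeIdealOf_isMaximal_of_isClosed ⟨x, hxU⟩ hxcl
  have hregB : ∀ P : Spec Γ(X, U), P.asIdeal ≠ 𝔭.asIdeal → P ∈ Scheme.regularLocus (Spec Γ(X, U)) := by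
    intro P hP
    rw [mem_regularLocus_iff_of_flat_of_isPreimmersion ι]
    have hPU : ι P ∈ U := by
      have : ι P ∈ Set.range ι := ⟨P, rfl⟩
      rwa [hιdef, hU.range_fromSpec] at this
    have hPx : ι P ≠ x := by
      intro h
      apply hP
      have : P = 𝔭 := ι.isOpenEmbedding.injective (h.trans hι𝔭.symm)
      rw [this]
    by_contra hnreg
    exact hUW hPU ⟨hnreg, hPx⟩
  have h𝔭0 : 𝔭.asIdeal ≠ ⊥ := by
    intro h0
    have hbot : (⊥ : Ideal Γ(X, U)).IsMaximal := h0 ▸ h𝔭max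
    obtain ⟨t, htU, htreg⟩ := (Scheme.dense_regularLocus X).inter_open_nonempty U U.2 ⟨x, hxU⟩
    have htr : t ∈ Set.range ι := by rw [hιdef, hU.range_fromSpec]; exact htU
    obtain ⟨P, rfl⟩ := htr
    have hP : P.asIdeal = 𝔭.asIdeal := by
      rw [h0]
      exact (hbot.eq_of_le P.isPrime.ne_top bot_le).symm
    have hP' : P = 𝔭 := PrimeSpectrum.ext hP
    rw [hP', hι𝔭] at htreg
    exact hx htreg
  obtain ⟨gk, hgk⟩ := Spec.map_surjective (ι ≫ f)
  letI : Algebra k Γ(X, U) := gk.hom.toAlgebra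
  have hιf : ι ≫ f = Spec.map (CommRingCat.ofHom (algebraMap k Γ(X, U))) := by
    rw [← hgk]; rfl
  haveI : Algebra.FiniteType k Γ(X, U) := by
    have h1 : LocallyOfFiniteType (Spec.map gk) := by rw [hgk]; infer_instance
    rw [HasRingHomProperty.Spec_iff (P := @LocallyOfFiniteType)] at h1
    exact h1
  -- the chart ring: a BASIC open `D(s) ∋ y` of `V₀` over `U`
  have hyU : y ∈ φ ⁻¹ᵁ U := hxU
  obtain ⟨s, hsle, hys⟩ := hV₀.exists_basicOpen_le (V := φ ⁻¹ᵁ U) ⟨y, hyU⟩ hy₀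
  have hV : IsAffineOpen (Y.basicOpen s) := hV₀.basicOpen s
  have e : Y.basicOpen s ≤ φ ⁻¹ᵁ U := hsle
  set ψ := φ.appLE U (Y.basicOpen s) e with hψdef
  have hψ : ψ.hom.Etale := φ.etale_appLE hU hV e
  letI : Algebra Γ(X, U) Γ(Y, Y.basicOpen s) := ψ.hom.toAlgebra
  haveI : Algebra.Etale Γ(X, U) Γ(Y, Y.basicOpen s) := hψ
  set 𝔔 := hV.primeIdealOf ⟨y, hys⟩ with h𝔔def
  have hcomap : 𝔔.asIdeal.comap (algebraMap Γ(X, U) Γ(Y, Y.basicOpen s)) = 𝔭.asIdeal := by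
    have h := hU.comap_primeIdealOf_appLE (f := φ) U (Y.basicOpen s) hV e hys
    exact congrArg PrimeSpectrum.asIdeal h
  haveI : 𝔔.asIdeal.LiesOver 𝔭.asIdeal := ⟨hcomap.symm⟩
  have hover : 𝔭.asIdeal ≤ 𝔔.asIdeal.comap (algebraMap Γ(X, U) Γ(Y, Y.basicOpen s)) := hcomap.ge
  have hunr : 𝔭.asIdeal.map (algebraMap Γ(X, U) (Localization.AtPrime 𝔔.asIdeal)) =
      IsLocalRing.maximalIdeal (Localization.AtPrime 𝔔.asIdeal) := by
    letI := Localization.AtPrime.algebraOfLiesOver 𝔭.asIdeal 𝔔.asIdeal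
    haveI : Algebra.IsUnramifiedAt Γ(X, U) 𝔔.asIdeal :=
      (Algebra.formallyUnramified_iff_forall).mp inferInstance 𝔔
    exact ((Algebra.isUnramifiedAt_iff_map_eq Γ(X, U) 𝔭.asIdeal 𝔔.asIdeal).mp inferInstance).2
  have hsing : ι ⟨𝔭.asIdeal, h𝔭max.isPrime⟩ ∉ Scheme.regularLocus X := by
    change ι 𝔭 ∉ _
    rw [hι𝔭]; exact hx
  have hregQ : Scheme.IsRegular (affineBlowup 𝔔.asIdeal) :=
    isRegular_affineBlowup_primeIdealOf_basicOpen hV₀ y hy₀ s hys hreg₀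
  obtain ⟨W, hxW, huniq, Z, ρ, hρ, hZ, hiso, hdense⟩ :=
    PointBlowupEtale.hloc_of_pointBlowup_flat_chart k X f ι hιf 𝔭.asIdeal h𝔭0 hsing hregB 𝔔.asIdeal
      hover hunr hregQ
  have hpt : ι ⟨𝔭.asIdeal, h𝔭max.isPrime⟩ = x := hι𝔭
  rw [hpt] at hxW huniq
  exact ⟨W, hxW, huniq, Z, ρ, hρ, hZ, hiso, hdense⟩

/-- **RESOLUTION FROM ÉTALE CHARTS WITH ONE REGULAR POINT BLOW-UP EACH.** Let `X` be an integral `k`-scheme locally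
of finite type (any field) with finitely many singular points, each the image of a point `y` of an étale `X`-scheme
`Y` admitting an affine open `V₀ ∋ y` on which the blow-up at `y` is regular. Then `X` has a resolution of
singularities. [cite: Kollar2007, §2.2] -/
theorem hasResolution_of_isolated_etale_pointBlowup_of_affineOpen (k : Type) [Field k] (X : Scheme.{0})
    [IsIntegral X] (f : X ⟶ Spec (.of k)) [LocallyOfFiniteType f] (hfin : (Scheme.regularLocus X)ᶜ.Finite)
    (hchart : ∀ x : X, x ∉ Scheme.regularLocus X →
      ∃ (Y : Scheme.{0}) (φ : Y ⟶ X) (_ : Etale φ) (y : Y) (_ : φ y = x)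
        (V₀ : Y.Opens) (hV₀ : IsAffineOpen V₀) (hy₀ : y ∈ V₀),
        Scheme.IsRegular (affineBlowup (hV₀.primeIdealOf ⟨y, hy₀⟩).asIdeal)) :
    Scheme.HasResolution X := by
  refine IsolatedGlue.hasResolution_of_finite_singularLocus_of_local k X f hfin fun s hs => ?_
  obtain ⟨Y, φ, _, y, hys, V₀, hV₀, hy₀, hreg₀⟩ := hchart s hs
  subst hys
  exact hloc_of_etale_chart_pointBlowup_of_affineOpen k X f hfin φ y hs V₀ hV₀ hy₀ hreg₀

end Summit.ResolutionOfSingularities.ResolutionOfSingularities.Theorems.FRationalResolution.EtaleChartAffineOpen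

end
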